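import Literature.Analysis.FluidPDE.StokesTorusPositivityProofs
import Literature.Analysis.FunctionSpaces.TorusFourierCalculus
import Summits.AnomalousDissipation.AnomalousDissipation.Theorems.SolenoidalFractalHomogenisationRealisedQuasiStaticCellLawGalerkinTransfer
import HarnessLib

/-!
# K2R `RealisedQuasiStaticCellLaw`, line `floquet-bloch`: the single-mode datum `Re(e_ℓ) p` of `stub_upperSome`
# (helper; `--supports stmt-AnomalousDissipation-20446`)

Summits-side helper file (everything proved; no definitions, no named facts). The datum of the upper law,
`x ↦ Re(e_ℓ(x)) p` with `ℓ ≠ 0` and `p ⊥ ℓ`, is the single real Fourier mode `realTrigPoly {ℓ} (fun _ => complexify p)`: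
smooth (hence `H¹`), divergence free, mean zero, Fourier-supported on `{±ℓ} ⊆ ±ℓ + nℤ³`. Consequently
(`exists_weak_singleMode_of_galerkinLowerBound`) a lower bound on the energy of the two modes `±ℓ` of the Galerkin
truncations of the cell problem, uniform (eventually) in the truncation order, is realised by a weak `A = 0` solution around
the cell — the form in which the Bloch-sector analysis delivers `stub_upperSome`.
-/

set_option linter.dupNamespace false

noncomputable section

namespace Summit.AnomalousDissipation.AnomalousDissipation.Theorems.SolenoidalFractalHomogenisation.RealisedQuasiStaticCellLaw

open Set MeasureTheory Filter Topology Function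
open scoped InnerProductSpace
open Literature.Analysis Literature.Analysis.FunctionSpaces Literature.Analysis.FunctionSpaces.Torus
open Literature.Analysis.FluidPDE Literature.Analysis.FluidPDE.LatticeShear

variable {k₀ : ℕ}

/-- The single-mode datum is the single real Fourier mode `realTrigPoly {ℓ} (fun _ => complexify p)`. -/
theorem singleMode_eq_realTrigPoly (ℓ : Fin 3 → ℤ) (p : EuclideanSpace ℝ (Fin 3)) :
    (fun x : UnitAddTorus (Fin 3) => (UnitAddTorus.mFourier ℓ x).re • p) =
      realTrigPoly {ℓ} (fun _ => EuclideanSpace.complexify p) := by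
  funext x
  rw [realTrigPoly_singleton_apply]
  ext i
  rw [PiLp.smul_apply, smul_eq_mul, EuclideanSpace.realPart_apply, PiLp.smul_apply, smul_eq_mul,
    EuclideanSpace.complexify_apply, Complex.re_mul_ofReal]

/-- The single-mode datum is smooth. -/
theorem isSmooth_singleMode (ℓ : Fin 3 → ℤ) (p : EuclideanSpace ℝ (Fin 3)) :
    IsSmooth (fun x : UnitAddTorus (Fin 3) => (UnitAddTorus.mFourier ℓ x).re • p) := by
  rw [singleMode_eq_realTrigPoly]; exact isSmooth_realTrigPoly _ _

/-- The single-mode datum is in `H¹` (complexified). -/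
theorem memSobolev_one_singleMode (ℓ : Fin 3 → ℤ) (p : EuclideanSpace ℝ (Fin 3)) :
    FunctionSpaces.Torus.MemSobolev 1
      (FunctionSpaces.EuclideanSpace.complexify ∘ fun x : UnitAddTorus (Fin 3) => (UnitAddTorus.mFourier ℓ x).re • p) :=
  (isSmooth_singleMode ℓ p).memSobolev_one_complexify

/-- The single-mode datum with `p ⊥ ℓ` is divergence free. -/
theorem isDivFree_singleMode (ℓ : Fin 3 → ℤ) {p : EuclideanSpace ℝ (Fin 3)} (hp : ⟪p, latticeVec ℓ⟫_ℝ = 0) :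
    IsDivFree (fun x : UnitAddTorus (Fin 3) => (UnitAddTorus.mFourier ℓ x).re • p) := by
  rw [singleMode_eq_realTrigPoly]
  refine isDivFree_realTrigPoly_singleton ?_
  have h : ∑ i : Fin 3, (ℓ i : ℝ) * p i = 0 := by
    rw [EuclideanSpace.inner_eq_star_dotProduct] at hp
    simpa [dotProduct, latticeVec_apply, mul_comm] using hp
  have h2 : ∑ j, ((ℓ j : ℤ) : ℂ) * (EuclideanSpace.complexify p) j = ((∑ i : Fin 3, (ℓ i : ℝ) * p i : ℝ) : ℂ) := by
    push_cast
    refine Finset.sum_congr rfl fun j _ => ?_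
    rw [EuclideanSpace.complexify_apply]
  rw [h2, h, Complex.ofReal_zero]

/-- The single-mode datum with `p ⊥ ℓ` is weakly divergence free. -/
theorem isWeaklyDivFree_singleMode (ℓ : Fin 3 → ℤ) {p : EuclideanSpace ℝ (Fin 3)} (hp : ⟪p, latticeVec ℓ⟫_ℝ = 0) :
    FunctionSpaces.Torus.IsWeaklyDivFree (fun x : UnitAddTorus (Fin 3) => (UnitAddTorus.mFourier ℓ x).re • p) :=
  (isDivFree_singleMode ℓ hp).isWeaklyDivFree_holds (isSmooth_singleMode ℓ p)

/-- The single-mode datum with `ℓ ≠ 0` has zero mean. -/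
theorem hasZeroMean_singleMode {ℓ : Fin 3 → ℤ} (hℓ : ℓ ≠ 0) (p : EuclideanSpace ℝ (Fin 3)) :
    FunctionSpaces.Torus.HasZeroMean (fun x : UnitAddTorus (Fin 3) => (UnitAddTorus.mFourier ℓ x).re • p) := by
  rw [singleMode_eq_realTrigPoly]; exact Torus.hasZeroMean_realTrigPoly_singleton_of_ne_zero hℓ _

/-- The Fourier coefficients of the single-mode datum vanish off `±ℓ`. -/
theorem mFourierCoeff_singleMode_eq_zero (ℓ : Fin 3 → ℤ) (p : EuclideanSpace ℝ (Fin 3)) {k : Fin 3 → ℤ}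
    (hk : k ≠ ℓ) (hk' : k ≠ -ℓ) :
    UnitAddTorus.mFourierCoeff (FunctionSpaces.EuclideanSpace.complexify ∘
      fun x : UnitAddTorus (Fin 3) => (UnitAddTorus.mFourier ℓ x).re • p) k = 0 := by
  rw [singleMode_eq_realTrigPoly, mFourierCoeff_realTrigPoly_singleton, if_neg hk, if_neg hk',
    EuclideanSpace.conjVec_zero, add_zero, smul_zero]

/-- The single-mode datum is Fourier-supported in the Bloch sector `±ℓ + nℤ³`. -/
theorem mFourierCoeff_singleMode_eq_zero_of_not_sector (ℓ : Fin 3 → ℤ) (p : EuclideanSpace ℝ (Fin 3)) (n : ℕ) :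
    ∀ k : Fin 3 → ℤ, ¬ ((∃ z : Fin 3 → ℤ, k = ℓ + (n:ℤ) • z) ∨ (∃ z : Fin 3 → ℤ, k = -ℓ + (n:ℤ) • z)) →
      UnitAddTorus.mFourierCoeff (FunctionSpaces.EuclideanSpace.complexify ∘
        fun x : UnitAddTorus (Fin 3) => (UnitAddTorus.mFourier ℓ x).re • p) k = 0 := by
  intro k hk
  refine mFourierCoeff_singleMode_eq_zero ℓ p ?_ ?_
  · rintro rfl
    exact hk (Or.inl ⟨0, by simp⟩)
  · rintro rfl
    exact hk (Or.inr ⟨0, by simp⟩)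

/-- **Galerkin lower bounds on the modes `±ℓ` are realised by a weak solution from the single-mode datum.** For a
lattice word `W`, `n ≥ 1`, `κ > 0`, `ℓ ≠ 0`, `p ⊥ ℓ`: if the Galerkin truncations of the cell problem in the sector
`±ℓ + nℤ³` from the datum `Re(e_ℓ) p` satisfy `Ψ t ≤ ‖α_N(t)(ℓ)‖² + ‖α_N(t)(-ℓ)‖²` for every `t ≥ 0`, eventually in `N`,
then for every `T > 0` some weak `A = 0` solution around `W.cell n` from this datum has `Ψ t ≤ ∫‖w t‖²` for a.e.
`t ∈ (0,T)`. -/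
theorem exists_weak_singleMode_of_galerkinLowerBound (W : LatticeWord k₀) {n : ℕ} (hn : 0 < n) {κ : ℝ} (hκ : 0 < κ)
    {ℓ : Fin 3 → ℤ} (hℓ : ℓ ≠ 0) {p : EuclideanSpace ℝ (Fin 3)} (hp : ⟪p, latticeVec ℓ⟫_ℝ = 0) {Ψ : ℝ → ℝ}
    (hΨ : ∀ᶠ N in atTop, ∀ t, 0 ≤ t →
      Ψ t ≤ ‖(pvSetup_cell W hn hκ.le ℓ (memSobolev_one_singleMode ℓ p) (isWeaklyDivFree_singleMode ℓ hp)
          (hasZeroMean_singleMode hℓ p) (mFourierCoeff_singleMode_eq_zero_of_not_sector ℓ p n)).galerkinCoeffAt N t ℓ‖ ^ 2 +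
        ‖(pvSetup_cell W hn hκ.le ℓ (memSobolev_one_singleMode ℓ p) (isWeaklyDivFree_singleMode ℓ hp)
          (hasZeroMean_singleMode hℓ p) (mFourierCoeff_singleMode_eq_zero_of_not_sector ℓ p n)).galerkinCoeffAt N t (-ℓ)‖ ^ 2)
    {T : ℝ} (hT : 0 < T) :
    ∃ w : ℝ → UnitAddTorus (Fin 3) → EuclideanSpace ℝ (Fin 3),
      Torus.IsWeakPassiveVectorOn 0 T κ (W.cell n) (fun x => (UnitAddTorus.mFourier ℓ x).re • p) w ∧
      ∀ᵐ t ∂(volume.restrict (Ioo 0 T)), Ψ t ≤ ∫ x, ‖w t x‖ ^ 2 := by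
  classical
  have hℓℓ : ℓ ≠ -ℓ := by
    intro h
    apply hℓ
    funext i
    have hi := congrFun h i
    simp only [Pi.neg_apply] at hi
    have : ℓ i = 0 := by omega
    simpa using this
  refine exists_weak_of_galerkinLowerBound W hn hκ ℓ (memSobolev_one_singleMode ℓ p) (isWeaklyDivFree_singleMode ℓ hp)
    (hasZeroMean_singleMode hℓ p) (mFourierCoeff_singleMode_eq_zero_of_not_sector ℓ p n) ({ℓ, -ℓ} : Finset (Fin 3 → ℤ))
    (Ψ := Ψ) (hΨ.mono fun N hN t ht => ?_) hT
  rw [Finset.sum_pair hℓℓ]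
  exact hN t ht

end Summit.AnomalousDissipation.AnomalousDissipation.Theorems.SolenoidalFractalHomogenisation.RealisedQuasiStaticCellLaw

end
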